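import Summits.ResolutionOfSingularities.ResolutionOfSingularities.Theorems.HilbertSamuelEliminationSigmaMaxModificationsCorridor3WLadderStrataLineages
import HarnessLib

/-!
# [OURS · L1 W4.2] The MOVING W-ladder from maximal origins: the NON-DEGENERACY row (D) and the CYCLE INVARIANT along
# chains — what every geometric row prover needs (`ν ≠ Φ^{(N)}`, permissible centres, `ν` maximal upstairs)

Crux chain w42 (`SigmaMaxModifications`, stmt-ResolutionOfSingularities-18506; skeleton `w_ladder` v5 on
`SigmaMaxModificationsCorridor3`, stmt-ResolutionOfSingularities-19249), seat res-L1-w42-stub-4 (gen 3); companion of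
`…Corridor3WLadderStrataLineages` (p500484), `…StrataLabels` (p503069), `…StrataCentre`. OURS (cell res-hironaka, slot W4.2);
NOT statements of H. Hironaka's manuscript [Hironaka2017] nor of [CossartJannsenSaito2020]; AI-drafted, weaker than expert
review. Every `theorem` is PROVED; the open content is the one `def … : Prop` row (D). Helper file
`--supports stmt-ResolutionOfSingularities-19249`.

## The point (FINDING of this seat, STATUS 2026-08-27)

The rows of the moving W-ladder (`Moving.MaxOriginNoMovingNearChainAt(Q)`, module `…Corridor3WLadderMovingDefs`) quantify over
maximal origins `CampaignW42.IsMaximalOrigin p N ν X x`, which do NOT record `ν ≠ Φ^{(N)}` (`iterPSum N Phi`, the value of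
`H^N` at regular points) — the consumer `nuMod_three_of_WAM_WBM` has it, the rows drop it. But every GEOMETRIC argument along a
chain of `S(X, ν)` runs on the tree's cycle invariant (`CampaignW42.isCanonicalStep_cycle_package`, p-TertiaryCycles): centres
regular, permissible and inside the strata, `H^N` non-increasing (so `ν` stays maximal upstairs and the strata stay closed), the
replayed subscheme equal to the treated part — and that package needs `ν ≠ Φ^{(N)}`. This file (i) isolates the degenerate case
as ONE row (D) `MaxOriginMovingNondegenerate p N` — «a maximal origin carrying a MOVING chain has `ν ≠ Φ^{(N)}`» (true: for
`ν = Φ^{(N)}` the scheme is regular, `S(X, ν)` replays unit ideals and then blows up the zero ideal, whose blow-up is empty, so no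
chain survives a blown-up stage; OPEN as a kernel statement) —, (ii) gives the combinator `QNe Q` («`Q` and `ν ≠ Φ^{(N)}`») with
`maxOriginNoMovingNearChainAtQ_of_qNe : (D) → row at `QNe Q` → row at `Q`» (and the recurrent variant), so that rows may be
proved UNDER `ν ≠ Φ^{(N)}` and the hypothesis discharged once by (D); and (iii) bundles the cycle invariant on marked stages,
`CycleInv k R N ν s`, proved at the initial stage of a maximal origin with `ν ≠ Φ^{(N)}` (`IsMaximalOrigin.exists_cycleInv`) and
propagated along canonical near steps / `Reaches` (`CycleInv.step`, `.of_reaches`), with its consequences for row provers: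
`CycleInv.centre` (the canonical centre is regular, in the stratum, permissible; `H^N` does not increase), `.stateGood`,
`.isClosed_hsStratum`, `.maximal`, `StepProjection.image_hsStratum_subset` (the blow-down maps the stratum into the stratum),
and `CycleInv.singleton_notMem_componentsIn_of_not_iso` (at a NEVER-ISOLATED marked point `{x_n}` is not a component of
`X_n(ν)`: the components through the chain point are positive-dimensional — the remark left open in p500484's docstring).

References: CJS LNM 2270 Rem. 6.29 (1), p. 92, Lemma 2.36, Lemma 5.34 (3), Thm. 3.3, Thm. 3.10 (1) [CossartJannsenSaito2020];
tree `…CampaignW42TertiaryCycles` (`isCanonicalStep_cycle_package`, `cycleInvariant_runs`), `…TertiaryStates` (`StateGood`),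
`…TertiaryGeneralStrata` (`stateGood_init_general`), `Literature…HilbertSamuelLowerBound` / `…GenericConstancyExcellent`.
-/

noncomputable section

-- plan-1/idea-2 module setting kept (namespace `…Corridor3.Moving` re-enters `…Corridor3`)
set_option linter.dupNamespace false

open CategoryTheory AlgebraicGeometry TopologicalSpace Topology
open Summit.ResolutionOfSingularities.ResolutionOfSingularities.Theorems.CampaignW42
open Literature.AlgebraicGeometry.Resolution Literature.RingTheory.HilbertSamuel
open Literature.AlgebraicGeometry.CossartJannsenSaito2020
open Summit.ResolutionOfSingularities.ResolutionOfSingularities.Theorems.SigmaMaxModificationsCorridor3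

universe u

namespace Summit.ResolutionOfSingularities.ResolutionOfSingularities.Theorems.SigmaMaxModificationsCorridor3.Moving

variable {R : ∀ S : Scheme.{u}, CentreSeq S → Prop} {N : ℕ} {ν : ℕ → ℕ}

/-! ## §1. Row (D): non-degeneracy, and the combinator `QNe` -/

/-- [OURS · L1 W4.2] **ROW (D) — NON-DEGENERACY: a maximal origin carrying a MOVING chain has `ν ≠ Φ^{(N)}`.** For every
functional admissible oracle, value `ν`, maximal origin `x ∈ X(ν)` of characteristic `p` at level `N`, and every chain of canonical
near steps from it whose marked point is blown up infinitely often: `ν` is not the regular value `Φ^{(N)} = iterPSum N Phi`.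
Why true: if `ν = Φ^{(N)}` is maximal then `Σ_X = {Φ^{(N)}}` (tree `Scheme.hsValues_eq_singleton_of_mem_hsMaxLocus`), `X` is
regular, the admissible oracle's centres lie over the empty non-regular locus (unit ideals, isomorphic blow-ups) and the cycle
ends by blowing up the reduced structure on the whole stage — the zero ideal, whose blow-up is EMPTY —, so no stage after a
blown-up one carries a point. OURS row, OPEN as a kernel statement (≈ blow-up of `⊥` is empty + iso-invariance of the
bookkeeping); NOT a statement of the manuscript. [cite: CossartJannsenSaito2020, Rem. 2.32, Rem. 6.29 (1)] -/
def MaxOriginMovingNondegenerate (p N : ℕ) : Prop :=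
  ∀ (R : ∀ S : Scheme.{u}, CentreSeq S → Prop), OracleFunctional R → OracleAdmissible R →
  ∀ (ν : ℕ → ℕ) (X : Scheme.{u}) [IsLocallyNoetherian X] (x : X), IsMaximalOrigin p N ν X x →
  ∀ c : ℕ → MarkedStage.{u}, Reaches R N ν (MarkedStage.init X x) (c 0) →
    (∀ n, CanonicalNearStep R N ν (c n) (c (n + 1))) → (∀ n, ∃ m, n ≤ m ∧ (c m).IsBlownUp R N ν) →
    ν ≠ iterPSum N Phi

/-- [OURS · L1 W4.2] The origin predicate `Q` STRENGTHENED BY NON-DEGENERACY: `Q` and `ν ≠ Φ^{(N)}`. [folklore] -/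
def QNe (Q : ℕ → (ℕ → ℕ) → ∀ X : Scheme.{u}, X → Prop) : ℕ → (ℕ → ℕ) → ∀ X : Scheme.{u}, X → Prop :=
  fun N ν X x => Q N ν X x ∧ ν ≠ iterPSum N Phi

/-- Unfolding. [folklore] -/
@[simp] theorem qNe_iff {Q : ℕ → (ℕ → ℕ) → ∀ X : Scheme.{u}, X → Prop} {N : ℕ} {ν : ℕ → ℕ} {X : Scheme.{u}} {x : X} :
    QNe Q N ν X x ↔ Q N ν X x ∧ ν ≠ iterPSum N Phi := Iff.rfl

/-- **Rows may be proved under `ν ≠ Φ^{(N)}`**: given (D), a moving row at `QNe Q` gives the moving row at `Q`. [folklore] -/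
theorem maxOriginNoMovingNearChainAtQ_of_qNe {p N : ℕ} {Q : ℕ → (ℕ → ℕ) → ∀ X : Scheme.{u}, X → Prop}
    {G : MarkedStage.{u} → Prop} (hD : MaxOriginMovingNondegenerate.{u} p N)
    (h : MaxOriginNoMovingNearChainAtQ p N (QNe Q) G) : MaxOriginNoMovingNearChainAtQ p N Q G := by
  intro R hRf hRa ν X _ x hX hQ
  rintro ⟨c, h0, hstep, hG, hmov⟩
  exact h R hRf hRa ν X x hX ⟨hQ, hD R hRf hRa ν X x hX c h0 hstep hmov⟩ ⟨c, h0, hstep, hG, hmov⟩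

/-- … the same for the moving-recurrent rows (units-half). [folklore] -/
theorem maxOriginNoMovingRecurrentNearChainAtQ_of_qNe {p N : ℕ} {Q : ℕ → (ℕ → ℕ) → ∀ X : Scheme.{u}, X → Prop}
    {G B : MarkedStage.{u} → Prop} (hD : MaxOriginMovingNondegenerate.{u} p N)
    (h : MaxOriginNoMovingRecurrentNearChainAtQ p N (QNe Q) G B) : MaxOriginNoMovingRecurrentNearChainAtQ p N Q G B := by
  intro R hRf hRa ν X _ x hX hQ
  rintro ⟨c, h0, hstep, hG, hmov, hrec⟩
  exact h R hRf hRa ν X x hX ⟨hQ, hD R hRf hRa ν X x hX c h0 hstep hmov⟩ ⟨c, h0, hstep, hG, hmov, hrec⟩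

/-- … and for the unrestricted rows (`Q = ⊤`). [folklore] -/
theorem maxOriginNoMovingNearChainAt_of_qNe {p N : ℕ} {G : MarkedStage.{u} → Prop} (hD : MaxOriginMovingNondegenerate.{u} p N)
    (h : MaxOriginNoMovingNearChainAtQ p N (QNe fun _ _ _ _ => True) G) : MaxOriginNoMovingNearChainAt p N G :=
  maxOriginNoMovingNearChainAt_of_atQ_true (maxOriginNoMovingNearChainAtQ_of_qNe hD h)

/-! ## §2. The cycle invariant on marked stages -/

/-- [OURS · L1 W4.2] **THE CYCLE INVARIANT of `S(X, ν)` AT A MARKED STAGE** (the hypotheses of the tree's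
`isCanonicalStep_cycle_package`, bundled): the stage is of finite type over the ground field `k`, reduced, of dimension `≤ N`,
`ν` is never exceeded by `H^N`, labels are `≤` the year, and inside a resolution cycle the replayed subscheme IS the treated part
`Y_n^{(j)}`, `j ≤` year, the centres still to be replayed are permissible and the replayed last stage is regular. OURS
bookkeeping; NOT a statement of the manuscript. [cite: CossartJannsenSaito2020, Rem. 6.29 (1), p. 92] -/
structure CycleInv (k : Type u) [Field k] (R : ∀ S : Scheme.{u}, CentreSeq S → Prop) (N : ℕ) (ν : ℕ → ℕ)
    (s : MarkedStage.{u}) : Prop where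
  /-- finite type over `k` -/
  overField : ∃ f : s.W ⟶ Spec (.of k), LocallyOfFiniteType f ∧ QuasiCompact f
  /-- reduced -/
  isReduced : IsReduced s.W
  /-- `dim ≤ N` -/
  dim_le : topologicalKrullDim s.W ≤ (N : WithBot ℕ∞)
  /-- `ν` is never exceeded -/
  supMax : ∀ w : s.W, ν ≤ Scheme.hsFun s.W N w → Scheme.hsFun s.W N w = ν
  /-- labels `≤` year -/
  label_le_year : ∀ Z, s.L.label Z ≤ s.L.year
  /-- inside a cycle: replayed subscheme = treated part, label `≤` year, remaining centres permissible, last stage regular -/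
  pending : ∀ Q, s.P = some Q →
    Set.range Q.hom.base = s.L.part (Scheme.hsStratum s.W N ν) Q.lbl ∧ Q.lbl ≤ s.L.year ∧
      Q.rest.AllPermissible ∧ Scheme.IsRegular Q.rest.top

/-- **The cycle invariant holds at the initial marked stage of a maximal origin.** [cite: CossartJannsenSaito2020, Rem. 6.29 (1)] -/
theorem _root_.Summit.ResolutionOfSingularities.ResolutionOfSingularities.Theorems.CampaignW42.IsMaximalOrigin.exists_cycleInv
    {p : ℕ} {X : Scheme.{u}} [IsLocallyNoetherian X] {x : X} (hX : IsMaximalOrigin p N ν X x) :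
    ∃ (k : Type u) (_ : Field k), CycleInv k R N ν (MarkedStage.init X x) := by
  obtain ⟨k, _, _, f, -, hft, hqc⟩ := hX.exists_structure
  exact ⟨k, inferInstance,
    { overField := ⟨f, hft, hqc⟩
      isReduced := hX.isReduced
      dim_le := hX.dim_le
      supMax := fun w hw => le_antisymm (hX.maximal.2 ⟨w, rfl⟩ hw) hw
      label_le_year := fun _ => le_rfl
      pending := fun Q h => by cases h }⟩

namespace CycleInv

variable {k : Type u} [Field k] {s s' : MarkedStage.{u}}

/-- A stage under the cycle invariant is locally Noetherian … [folklore] -/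
theorem isLocallyNoetherian (_h : CycleInv k R N ν s) : IsLocallyNoetherian s.W := s.ln

/-- … Noetherian … [folklore] -/
theorem isNoetherian (h : CycleInv k R N ν s) : IsNoetherian s.W := by
  obtain ⟨f, hf, hq⟩ := h.overField
  exact Scheme.isNoetherian_of_finiteType_over_field f

/-- … and excellent. [cite: StacksProject, Tag 07QW] -/
theorem isExcellent (h : CycleInv k R N ν s) : Scheme.IsExcellent s.W := by
  obtain ⟨f, hf, -⟩ := h.overField
  exact Scheme.isExcellent_of_locallyOfFiniteType Stacks07QW_field_holds f

/-- The `ν`-stratum is `X_n(≥ ν)` … [folklore] -/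
theorem hsStratum_eq_hsStratumGE (h : CycleInv k R N ν s) : Scheme.hsStratum s.W N ν = Scheme.hsStratumGE s.W N ν :=
  hsStratum_eq_hsStratumGE_of_supMax h.supMax

/-- … hence closed (CJS Lemma 2.36 over a field). [cite: CossartJannsenSaito2020, Lemma 2.36] -/
theorem isClosed_hsStratum (h : CycleInv k R N ν s) : IsClosed (Scheme.hsStratum s.W N ν) := by
  obtain ⟨f, hf, hq⟩ := h.overField
  rw [h.hsStratum_eq_hsStratumGE]
  exact isClosed_hsStratumGE_over_field f h.dim_le ν

/-- Every `X_n(≥ μ)` is closed. [cite: CossartJannsenSaito2020, Lemma 2.36] -/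
theorem isClosed_hsStratumGE (h : CycleInv k R N ν s) (μ : ℕ → ℕ) : IsClosed (Scheme.hsStratumGE s.W N μ) := by
  obtain ⟨f, hf, hq⟩ := h.overField
  exact isClosed_hsStratumGE_over_field f h.dim_le μ

/-- Finitely many values of `H^N`. [cite: CossartJannsenSaito2020, Lemma 2.36] -/
theorem finite_hsValues (h : CycleInv k R N ν s) : (Scheme.hsValues s.W N).Finite := by
  haveI := h.isLocallyNoetherian
  haveI := h.isNoetherian
  exact Scheme.finite_hsValues_of_isExcellent h.isExcellent N (hsPsi_le_of_dim_le' h.dim_le)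

/-- `ν` is a maximal value as soon as it is a value (e.g. at the marked point). [folklore] -/
theorem maximal (h : CycleInv k R N ν s) {y : s.W} (hy : y ∈ Scheme.hsStratum s.W N ν) :
    Maximal (· ∈ Scheme.hsValues s.W N) ν := by
  refine ⟨⟨y, hy⟩, fun μ hμ hle => ?_⟩
  obtain ⟨w, rfl⟩ := hμ
  exact (h.supMax w hle).le

/-- **THE CANONICAL CENTRE UNDER THE CYCLE INVARIANT (admissible oracle, `ν ≠ Φ^{(N)}`)**: regular, inside `X_n(ν)`,
PERMISSIBLE, and `H^N` does not increase along its blow-up (tree `isCanonicalStep_cycle_package`).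
[cite: CossartJannsenSaito2020, Rem. 6.29 (1), p. 92, Lemma 5.34 (3), Thm. 3.3, Thm. 3.10 (1)] -/
theorem centre (hRa : OracleAdmissible R) (hν : ν ≠ iterPSum N Phi) (h : CycleInv k R N ν s) {C : s.W.IdealSheafData}
    {P' : Option (Pending (blowup C))} (hcs : IsCanonicalStep R N ν s.L s.P C P') :
    Scheme.IsRegular C.subscheme ∧ (C.support : Set s.W) ⊆ Scheme.hsStratum s.W N ν ∧ IdealSheafData.IsPermissible C ∧
      ∀ z : ↥(blowup C), Scheme.hsFun (blowup C) N z ≤ Scheme.hsFun s.W N ((blowup.π C).base z) := by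
  obtain ⟨h1, h2, h3, h4, -⟩ :=
    isCanonicalStep_cycle_package (k := k) hRa hν h.overField h.isReduced h.dim_le h.supMax h.label_le_year h.pending hcs
  exact ⟨h1, h2, h3, h4⟩

/-- **THE CYCLE INVARIANT PROPAGATES ALONG CANONICAL NEAR STEPS** (admissible oracle, `ν ≠ Φ^{(N)}`).
[cite: CossartJannsenSaito2020, Rem. 6.29 (1), p. 92] -/
theorem step (hRa : OracleAdmissible R) (hν : ν ≠ iterPSum N Phi) (h : CycleInv k R N ν s)
    (hst : CanonicalNearStep R N ν s s') : CycleInv k R N ν s' := by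
  obtain ⟨C, P', hln, x', hcs, -, -, -, rfl⟩ := hst
  obtain ⟨-, -, -, -, hk', hred', hdim', hsup', hlab', hpend'⟩ :=
    isCanonicalStep_cycle_package (k := k) hRa hν h.overField h.isReduced h.dim_le h.supMax h.label_le_year h.pending hcs
  exact ⟨hk', hred', hdim', hsup', hlab', hpend'⟩

/-- … and along `Reaches`. [folklore] -/
theorem of_reaches (hRa : OracleAdmissible R) (hν : ν ≠ iterPSum N Phi) (h : CycleInv k R N ν s)
    (hr : Reaches R N ν s s') : CycleInv k R N ν s' := by
  induction hr with
  | refl => exact h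
  | tail _ hlast ih => exact ih.step hRa hν hlast

/-- Along every canonical run from a stage under the cycle invariant all centres are regular, permissible and in the strata
(tree `cycleInvariant_runs`). [cite: CossartJannsenSaito2020, Rem. 6.29 (1), p. 92, Lemma 5.34 (3)] -/
theorem runs (hRa : OracleAdmissible R) (hν : ν ≠ iterPSum N Phi) (h : CycleInv k R N ν s) (t : CentreSeq s.W)
    (ht : IsCanonicalRunFrom R N ν s.L s.P t) : t.AllRegular ∧ t.AllPermissible ∧ t.CentresInStratum N ν :=
  cycleInvariant_runs (k := k) hRa hν h.overField h.isReduced h.dim_le h.supMax h.label_le_year h.pending t ht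

/-- **A stage under the cycle invariant is a GOOD state** (`StateGood`, p477843): the Compactness / Liveness / InStratum
machinery of the campaign applies along chains from maximal origins with `ν ≠ Φ^{(N)}`. [folklore] -/
theorem stateGood (hRa : OracleAdmissible R) (hν : ν ≠ iterPSum N Phi) (h : CycleInv k R N ν s) :
    StateGood k R N ν s.W s.L s.P :=
  ⟨h.overField, h.dim_le, h.supMax, fun t ht => (h.runs hRa hν t ht).2.1⟩

end CycleInv

/-- **Along a chain from a maximal origin with `ν ≠ Φ^{(N)}` every stage is under the cycle invariant** (for the ground field of
the origin). [cite: CossartJannsenSaito2020, Rem. 6.29 (1)] -/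
theorem exists_cycleInv_chain {p : ℕ} (hRa : OracleAdmissible R) (hν : ν ≠ iterPSum N Phi) {X : Scheme.{u}}
    [IsLocallyNoetherian X] {x : X} (hX : IsMaximalOrigin p N ν X x) {c : ℕ → MarkedStage.{u}}
    (h0 : Reaches R N ν (MarkedStage.init X x) (c 0)) (hstep : ∀ n, CanonicalNearStep R N ν (c n) (c (n + 1))) :
    ∃ (k : Type u) (_ : Field k), ∀ n, CycleInv k R N ν (c n) := by
  obtain ⟨k, _, hinit⟩ := hX.exists_cycleInv (R := R)
  exact ⟨k, inferInstance, fun n => hinit.of_reaches hRa hν (reaches_chain h0 hstep n)⟩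

/-! ## §3. Consequences for the step projections and the components through the chain points -/

/-- **The blow-down of a canonical near step maps the stratum into the stratum** (`H^N` does not increase at the points of a
permissible blow-up, `ν` maximal). [cite: CossartJannsenSaito2020, Thm. 3.10 (1)] -/
theorem StepProjection.image_hsStratum_subset {k : Type u} [Field k] (hRa : OracleAdmissible R) (hν : ν ≠ iterPSum N Phi)
    {s s' : MarkedStage.{u}} (h : CycleInv k R N ν s) {f : s'.W ⟶ s.W} (hf : StepProjection R N ν s s' f) :
    f.base '' Scheme.hsStratum s'.W N ν ⊆ Scheme.hsStratum s.W N ν := by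
  obtain ⟨C, P', hln, x', hcs, -, -, -, e, rfl⟩ := hf
  subst e
  obtain ⟨-, -, -, hmono⟩ := h.centre hRa hν hcs
  rintro _ ⟨z, hz, rfl⟩
  simp only [eqToHom_refl, Category.id_comp]
  exact h.supMax _ ((Scheme.mem_hsStratum_iff.mp hz).symm.le.trans (hmono z))

/-- **The centre of a step projection is permissible, regular and inside the stratum**, read on the actual stages: there are
step data `(C, P')` with `IsCanonicalStep … C P'` (unique for a functional oracle) whose centre has these properties.
[cite: CossartJannsenSaito2020, Lemma 5.34 (3), Thm. 3.3] -/
theorem CycleInv.exists_centre {k : Type u} [Field k] (hRa : OracleAdmissible R) (hν : ν ≠ iterPSum N Phi)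
    {s s' : MarkedStage.{u}} (h : CycleInv k R N ν s) (hst : CanonicalNearStep R N ν s s') :
    ∃ (C : s.W.IdealSheafData) (P' : Option (Pending (blowup C))), IsCanonicalStep R N ν s.L s.P C P' ∧
      Scheme.IsRegular C.subscheme ∧ (C.support : Set s.W) ⊆ Scheme.hsStratum s.W N ν ∧ IdealSheafData.IsPermissible C := by
  obtain ⟨C, P', hln, x', hcs, -, -, -, -⟩ := hst
  obtain ⟨h1, h2, h3, -⟩ := h.centre hRa hν hcs
  exact ⟨C, P', hcs, h1, h2, h3⟩

/-- **AT A NEVER-ISOLATED MARKED POINT `{x_n}` IS NOT A COMPONENT OF `X_n(ν)`** (under the cycle invariant): if `{x_n}` were an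
irreducible component, the complement of the other (finitely many, closed) components and of the other (finitely many, closed)
maximal strata `X_n(≥ μ)` would be an open set meeting `X_max` in `{x_n}` exactly. So the lineages of p500484 through a
never-isolated chain point are positive-dimensional. [cite: CossartJannsenSaito2020, Lemma 2.36, Def. 2.35] -/
theorem CycleInv.singleton_notMem_componentsIn_of_not_iso {k : Type u} [Field k] {s : MarkedStage.{u}} (h : CycleInv k R N ν s)
    (hpt : s.pt ∈ Scheme.hsStratum s.W N ν) (hni : ¬ Iso N s) :
    {s.pt} ∉ componentsIn (Scheme.hsStratum s.W N ν) := by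
  intro hmem
  haveI := h.isLocallyNoetherian
  haveI := h.isNoetherian
  apply hni
  -- the other components
  let 𝒜 : Set (Set s.W) := {Z | Z ∈ componentsIn (Scheme.hsStratum s.W N ν) ∧ Z ≠ {s.pt}}
  have h𝒜fin : 𝒜.Finite := (componentsIn.finite _).subset fun _ hZ => hZ.1
  have h𝒜cl : IsClosed (⋃₀ 𝒜) := by
    rw [Set.sUnion_eq_biUnion]
    exact h𝒜fin.isClosed_biUnion fun Z hZ => componentsIn.isClosed h.isClosed_hsStratum hZ.1
  have hpt𝒜 : s.pt ∉ ⋃₀ 𝒜 := by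
    rintro ⟨Z, ⟨hZ, hne⟩, hxZ⟩
    apply hne
    refine Set.Subset.antisymm ?_ (Set.singleton_subset_iff.mpr hxZ)
    exact (mem_componentsIn_iff.mp hmem).2.2 Z (componentsIn.subset hZ) (componentsIn.isIrreducible hZ)
      (Set.singleton_subset_iff.mpr hxZ)
  -- the other maximal strata
  let ℳ : Set (ℕ → ℕ) := {μ | Maximal (· ∈ Scheme.hsValues s.W N) μ ∧ μ ≠ ν}
  have hℳfin : ℳ.Finite := h.finite_hsValues.subset fun _ hμ => hμ.1.1
  have hℳcl : IsClosed (⋃ μ ∈ ℳ, Scheme.hsStratumGE s.W N μ) := hℳfin.isClosed_biUnion fun μ _ => h.isClosed_hsStratumGE μ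
  have hptℳ : s.pt ∉ ⋃ μ ∈ ℳ, Scheme.hsStratumGE s.W N μ := by
    simp only [Set.mem_iUnion, Scheme.mem_hsStratumGE_iff, exists_prop, not_exists, not_and]
    intro μ hμ hle
    have hμν : μ ≤ ν := (Scheme.mem_hsStratum_iff.mp hpt) ▸ hle
    exact hμ.2 (le_antisymm hμν (hμ.1.2 ⟨s.pt, Scheme.mem_hsStratum_iff.mp hpt⟩ hμν))
  refine ⟨(⋃₀ 𝒜)ᶜ ∩ (⋃ μ ∈ ℳ, Scheme.hsStratumGE s.W N μ)ᶜ, h𝒜cl.isOpen_compl.inter hℳcl.isOpen_compl, ?_⟩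
  refine Set.Subset.antisymm ?_ (Set.singleton_subset_iff.mpr ⟨⟨hpt𝒜, hptℳ⟩, ?_⟩)
  · rintro y ⟨⟨hy𝒜, hyℳ⟩, hymax⟩
    -- `H(y)` is a maximal value; it is `ν`, for otherwise `y ∈ X(≥ H y)` with `H y ∈ ℳ`
    have hyν : Scheme.hsFun s.W N y = ν := by
      by_contra hne
      apply hyℳ
      simp only [Set.mem_iUnion, Scheme.mem_hsStratumGE_iff, exists_prop]
      exact ⟨Scheme.hsFun s.W N y, ⟨Scheme.mem_hsMaxLocus_iff.mp hymax, hne⟩, le_rfl⟩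
    obtain ⟨Z, hZ, hyZ⟩ := componentsIn.exists_mem (Scheme.mem_hsStratum_iff.mpr hyν)
    by_contra hyx
    exact hy𝒜 ⟨Z, ⟨hZ, fun hZe => hyx (hZe ▸ hyZ)⟩, hyZ⟩
  · rw [Scheme.mem_hsMaxLocus_iff, Scheme.mem_hsStratum_iff.mp hpt]
    exact h.maximal hpt

/-- Hence, under the cycle invariant, **every component through a never-isolated chain point has a second point** (is not
`{x_n}`). [folklore] -/
theorem CycleInv.exists_ne_of_mem_componentsThrough {k : Type u} [Field k] {s : MarkedStage.{u}} (h : CycleInv k R N ν s)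
    (hpt : s.pt ∈ Scheme.hsStratum s.W N ν) (hni : ¬ Iso N s) {Z : Set s.W} (hZ : Z ∈ componentsThrough N ν s) :
    ∃ y ∈ Z, y ≠ s.pt := by
  by_contra hno
  push Not at hno
  have hZe : Z = {s.pt} :=
    Set.Subset.antisymm (fun y hy => hno y hy) (Set.singleton_subset_iff.mpr hZ.2)
  exact h.singleton_notMem_componentsIn_of_not_iso hpt hni (hZe ▸ hZ.1)

end Summit.ResolutionOfSingularities.ResolutionOfSingularities.Theorems.SigmaMaxModificationsCorridor3.Moving

end
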